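import Literature.MathematicalPhysics.KineticTheory.InfiniteChainSuperstableDynamics
import Literature.MathematicalPhysics.KineticTheory.InfiniteChainInvariantStates
import HarnessLib

/-!
# Buttà–Marchioro 2016, Theorem 2.2: the almost-linear light cone of the infinite anharmonic chain

Topic `Literature/MathematicalPhysics/KineticTheory`; companion of
`InfiniteChainSuperstableDynamics.lean` (BM's local energy `bmLocalEnergy`, growth functional
`bmGrowth` = `Q`, good set `bmGood` = `𝒳₀`, superstability estimate `HasSuperstabilityEstimate`
(2.3), the polynomial hypothesis `IsEvenPolyOfDegree`, and the named facts
`ButtaMarchioro2016_thm21_chain` (Thm 2.1: the group `Φ_t` on `𝒳₀`) and `_eq26_chain`) and of the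
fact-free `InfiniteChainInvariantStates.lean` (coordinate derivatives `partialQZ`, `partialPZ`).
Vendored by a grounder of route `CurrentTiltQuench` of `AtomisticToContinuum/FouriersLaw`: the
"light-cone quasi-locality of the infinite QUARTIC-coupling flow" that its cruxes
`QuenchCurrentDies` (stmt-AtomisticToContinuum-11028, the `L → ∞` limit at fixed `τ`) and
`UniformQuadraticResponse` (stmt-11026, `L₀(ε, τ)`) and the support `DrudeFromTruncation`
(stmt-11032, the `L → ∞` swap) name as their dynamical input, flagged "unprinted" by three grounder
generations (Buttà et al. 2007 Thm 2.2 is quartic pinning with HARMONIC coupling), is printed for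
all even non-negative polynomial `U`, `V` in `d = 1` as Thm 2.2 of P. Buttà, C. Marchioro,
*Dynamics of infinite classical anharmonic crystals*, J. Stat. Phys. 164 (2016) 680–692,
arXiv:1602.01294, p. 5 [ButtaMarchioro2016]. Also relevant to `NoHiddenCharges.GibbsHydroStructure`
(stmt-3658) and `ContactEchoWindows` (cone `r ∼ t log^α t`).

## The printed statement (§2, p. 5)

Local observables: `f_i(x) = f(x_i)`, `g_j(x) = g(x_j)` for `f, g : ℝ^{2ν} → ℝ` "differentiable with
bounded derivatives"; Poisson bracket `{f,g}(x) = Σ_{i∈ℤ^d} [(D_{q_i}f)ᵀ D_{p_i}g - (D_{p_i}f)ᵀ D_{q_i}g](x)`;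
"A time invariant state `ω` is a probability measure on `𝒳` for which (2.3) holds and such that
`ω(Φ_t f) = ω(f)` for any `f ∈ 𝒰` and `t ∈ ℝ`." **Theorem 2.2.** "Let `ω` be any time invariant state
satisfying (2.3). Then, for each `f, g` as above, `i ∈ ℤ^d`, `α > (4-ηd)/(2-ηd)`, and `b > 0`,
`lim_{t→∞} sup_{j : |i-j| > t log^α t} e^{bt} {f_i, Φ_t g_j}(x) = 0`, almost surely with respect to
the probability measure `ω`." Remark (ibid.): "an improved version of (2.8), with `|i-j| > t log^α t`
replaced by `|i-j| > ct` for some `c > 0`, would imply a finite velocity of propagation. On the other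
hand, it is not clear to us that such improved estimate be valid for this type of observables."
Here `d = ν = 1`, `η = (σ-1)/σ`, `σ = max{σ₁, σ₂}`.

## Transcription choices (read before using the fact)

* THE FLOW. `Φ` is "the" group of Thm 2.1; it enters as ANY `Φ : ℝ → ChainConfig → ChainConfig`
  with all the properties listed in `ButtaMarchioro2016_thm21_chain` (maps `𝒳₀` to itself, `Φ₀ = id`
  and group law on `𝒳₀`, orbits solve the equations, uniqueness among `𝒳₀`-valued solutions, the
  growth bound (2.7)); by that uniqueness clause two such `Φ` agree on `𝒳₀`, so nothing is lost.
* TIME INVARIANCE. BM's definition is invariance on local observables, but the proof (§4, p. 9: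
  "since `ω` is time invariant, `ω(Q∘Φ_k > log^δ k) = ω(Q > log^δ k)`") uses invariance of the MEASURE
  under `Φ_k` on a non-local event; the fact takes the stronger hypothesis
  `∀ t, MeasurePreserving (Φ t) ω ω` (hence a weaker fact), plus (2.3) (`HasSuperstabilityEstimate`,
  which includes "probability measure") and `ω(𝒳₀ᶜ) = 0` (given by (2.6)).
* THE BRACKET. For `F = f_i` only the `i`-th term of `{F, G}` is non-zero; the fact is stated with
  that term, `sitePoissonBracket i`, built from the tree's coordinate-line derivatives `partialQZ`,
  `partialPZ` (one-variable `deriv`s; junk `0` where non-differentiable — BM's `x_i ↦ Φ_t(x)_j` IS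
  differentiable, Buttà et al. 2007 Thm 2.1 / BM §4 (4.2), not restated here).
* THE LIMIT. §4 proves `|{f_i, Φ_t g_j}(x)| ≤ C ‖Df‖_∞ ‖Dg‖_∞ ‖Δ_{j,i}(t,x)‖` and
  `lim_t sup_j e^{bt} ‖Δ_{j,i}(t,x)‖ = 0` on a set `ℬ` of full measure, i.e. the statement WITH absolute
  values; it is transcribed with `|·|` in the junk-free form "`∀ ε > 0`, eventually in `t`, for all
  `j` with `|i-j| > t log^α t`, `e^{bt} |{f_i, Φ_t g_j}(x)| ≤ ε`" (no real `sup` over infinitely many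
  `j`).

Everything here is a definition or a statement; nothing is asserted as a theorem.
-/

noncomputable section

open MeasureTheory Set Filter
open scoped Topology

namespace Literature.MathematicalPhysics.KineticTheory.HeatConduction

/-- The single-site observable `f_i(x) = f(x_i)` of a function `f` of one oscillator's `(q, p)`
(BM: "we denote by `f_i`, resp. `g_j`, the local observable given by `f_i(x) = f(x_i)`, resp.
`g_j(x) = g(x_j)`"). [cite: ButtaMarchioro2016, §2 before Thm 2.2] -/
def siteObs (f : ℝ × ℝ → ℝ) (i : ℤ) : ChainConfig → ℝ := fun σ => f (σ i)

/-- The `i`-th term `(∂_{q_i}F ∂_{p_i}G - ∂_{p_i}F ∂_{q_i}G)(x)` of BM's Poisson bracket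
`{F, G}(x) = Σ_{i∈ℤ} (D_{q_i}F D_{p_i}G - D_{p_i}F D_{q_i}G)(x)` (scalar case `ν = 1`), with the tree's
coordinate derivatives `partialQZ`, `partialPZ`; it is the whole bracket when `F` depends on the
coordinate `x_i` only (every other term vanishes), the only case Thm 2.2 uses (`F = f_i`).
[cite: ButtaMarchioro2016, §2 (Poisson brackets, before Thm 2.2)] -/
def sitePoissonBracket (i : ℤ) (F G : ChainConfig → ℝ) (σ : ChainConfig) : ℝ :=
  partialQZ i F σ * partialPZ i G σ - partialPZ i F σ * partialQZ i G σ

/-- Unfolding `siteObs`. [folklore] -/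
@[simp] theorem siteObs_apply (f : ℝ × ℝ → ℝ) (i : ℤ) (σ : ChainConfig) :
    siteObs f i σ = f (σ i) := rfl

namespace OscillatorChain

/-- **Buttà–Marchioro 2016, Theorem 2.2, for the chain (`d = ν = 1`): the almost-linear light cone.**
For `U`, `V` even non-negative polynomials of degrees `2σ₁, 2σ₂ ≥ 2`, `Φ` the group of Thm 2.1 on
`𝒳₀` (entered through its full list of properties), and `ω` a time invariant state with the
superstability estimate (2.3) (measure-preserving form, carried by `𝒳₀`): for all `f, g : ℝ² → ℝ`
differentiable with bounded derivatives, `i ∈ ℤ`, `α > (4-η)/(2-η)` (`η = (σ-1)/σ`,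
`σ = max{σ₁,σ₂}`) and `b > 0`, `ω`-almost surely
`lim_{t→∞} sup_{j : |i-j| > t log^α t} e^{bt} |{f_i, Φ_t g_j}(x)| = 0` (in the `∀ ε`, eventually,
`∀ j` form). See the module docstring for the transcription choices. Statement only; grounds the
quasi-locality input of `Summit.AtomisticToContinuum.FouriersLaw.Theses.CurrentTiltQuench.QuenchCurrentDies`
/ `.UniformQuadraticResponse` / `.DrudeFromTruncation`. [cite: ButtaMarchioro2016, §2 Thm 2.2] -/
def ButtaMarchioro2016_thm22_chain : Prop :=
  ∀ (P : OscillatorChain) (s₁ s₂ : ℕ), 1 ≤ s₁ → 1 ≤ s₂ →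
    IsEvenPolyOfDegree P.U s₁ → IsEvenPolyOfDegree P.V s₂ →
    ∀ Φ : ℝ → ChainConfig → ChainConfig,
      (∀ t : ℝ, MapsTo (Φ t) P.bmGood P.bmGood) →
      (∀ σ ∈ P.bmGood, Φ 0 σ = σ) →
      (∀ t s : ℝ, ∀ σ ∈ P.bmGood, Φ (t + s) σ = Φ t (Φ s σ)) →
      (∀ σ ∈ P.bmGood, P.IsSolution fun t => Φ t σ) →
      (∀ σ ∈ P.bmGood, ∀ γ : ℝ → ChainConfig, γ 0 = σ → P.IsSolution γ →
        (∀ t : ℝ, γ t ∈ P.bmGood) → ∀ t : ℝ, γ t = Φ t σ) →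
      (∀ γ' : ℝ, (((max s₁ s₂ : ℕ) : ℝ) - 1) / ((max s₁ s₂ : ℕ) : ℝ) < γ' → γ' < 2 →
        ∀ β' : ℝ, 0 < β' → ∃ C : ℝ, 0 < C ∧ ∀ t : ℝ, 0 < t → ∀ σ ∈ P.bmGood,
          P.bmGrowth (Φ t σ) ≤ C * P.bmGrowth σ *
            (1 + t ^ (2 / (2 - γ')) * (1 + t ^ β') * P.bmGrowth σ ^ (γ' / (2 - γ')))) →
    ∀ ω : Measure ChainConfig, P.HasSuperstabilityEstimate ω → ω (P.bmGood)ᶜ = 0 →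
      (∀ t : ℝ, MeasurePreserving (Φ t) ω ω) →
    ∀ (f g : ℝ × ℝ → ℝ), Differentiable ℝ f → Differentiable ℝ g →
      (∃ M : ℝ, ∀ z, ‖fderiv ℝ f z‖ ≤ M) → (∃ M : ℝ, ∀ z, ‖fderiv ℝ g z‖ ≤ M) →
    ∀ (i : ℤ) (α : ℝ),
      (4 - ((((max s₁ s₂ : ℕ) : ℝ) - 1) / ((max s₁ s₂ : ℕ) : ℝ))) /
          (2 - ((((max s₁ s₂ : ℕ) : ℝ) - 1) / ((max s₁ s₂ : ℕ) : ℝ))) < α →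
    ∀ b : ℝ, 0 < b →
      ∀ᵐ x ∂ω, ∀ ε : ℝ, 0 < ε → ∀ᶠ t : ℝ in atTop, ∀ j : ℤ,
        t * Real.log t ^ α < |((i : ℝ) - (j : ℝ))| →
          Real.exp (b * t) * |sitePoissonBracket i (siteObs f i) (siteObs g j ∘ Φ t) x| ≤ ε

end OscillatorChain

end Literature.MathematicalPhysics.KineticTheory.HeatConduction

end
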